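import Summits.ValiantsHypothesis.ValiantsHypothesis.Theorems.MonotoneRestorationOrbitRestorationQPSignFree
import Summits.ValiantsHypothesis.ValiantsHypothesis.Theorems.MonotoneRestorationOrbitRestorationQPProductAction
import HarnessLib

/-!
# Canonical supports for an abstract action; ROW and COLUMN supports (ORBIT currency, ΠΣ sub-rung)

Route MonotoneRestoration, crux `OrbitRestorationQP` (stmt-ValiantsHypothesis-18293), line `depth-three-rung`,
stub A₁ `stub_piSigmaValue`, namespace `Summit.ValiantsHypothesis.ValiantsHypothesis.Theorems.RowColSupport`.

Rule M2′ of the crux workfile `Cruxes/OrbitRestorationQP/PISIGMA-SUBRUNG.md` keys a factor `ℓ` of a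
MATRIX-symmetric affine product by its ROW support `R_ℓ`, its COLUMN support `C_ℓ`, or `R_ℓ ∪ C_ℓ`; the keyed-block
theorem (`KeyedBlocks.qpOrbitRestorable_of_keyedBlocks`, parity form `KeyedParity.…_parity`) wants these as
FUNCTIONS on all polynomials, unit-invariant and equivariant for the DIAGONAL action.  This file supplies them.

* `exists_supportAssignment A` — the canonical support of `SignFree.exists_supportAssignment`, verbatim, for an
  ABSTRACT action `A : Sym(Fin n) →* (K[V] ≃ₐ K[V])` (`i ∈ supp q` iff `i` has at most `n/2 + 1` partners `j`
  with `A (i j) q = q`): (S1) unit-invariant, (S2) `A`-equivariant, (S2') invariant under every algebra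
  automorphism commuting with the action, (S3) dominated by — and as good as — any pointwise-stabiliser support
  `X` with `2|X| + 5 ≤ n`;
* `row_col_comm` — the pure row and pure column actions commute;
* **`exists_rowColSupports n`** — row and column supports `R, C : K[x_ij] → Finset (Fin n)` on the `n × n`
  matrix: unit-invariant; `R (row σ · q) = σ • R q`, `R (col τ · q) = R q`, and symmetrically for `C`; hence
  DIAGONALLY equivariant, `R (ren σ q) = σ • R q`, `C (ren σ q) = σ • C q`; and (S3) for the row (column)
  pointwise stabilisers.

Everything is proved, over any field. [folklore]

## References
* A. Dawar, G. Wilsenach, *Symmetric arithmetic circuits*, ToC 21 (2025), Def. 6.1 (supports). [DawarWilsenach2025]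
-/

noncomputable section

open scoped Classical Pointwise

-- `Summit.ValiantsHypothesis.ValiantsHypothesis.…` is the tree's single-conjunct layout (Sub = Summit).
set_option linter.dupNamespace false

namespace Summit.ValiantsHypothesis.ValiantsHypothesis.Theorems

namespace RowColSupport

open MvPolynomial Equiv Finset ProductAction

variable {n : ℕ} {K : Type} [Field K] {V : Type}

/-! ### Bookkeeping for an abstract action -/

section Abstract

variable (A : Perm (Fin n) →* (MvPolynomial V K ≃ₐ[K] MvPolynomial V K))

/-- The action fixes constants. [folklore] -/
theorem act_C (ρ : Perm (Fin n)) (u : K) : A ρ (C u) = C u := by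
  rw [← MvPolynomial.algebraMap_eq]; exact (A ρ).commutes u

/-- The action of a product. [folklore] -/
theorem act_mul_apply (a b : Perm (Fin n)) (q : MvPolynomial V K) : A (a * b) q = A a (A b q) := by
  rw [map_mul, AlgEquiv.mul_apply]

/-- The identity acts trivially. [folklore] -/
theorem act_one (q : MvPolynomial V K) : A 1 q = q := by
  rw [map_one, AlgEquiv.one_apply]

/-- `A σ⁻¹ (A σ q) = q`. [folklore] -/
theorem act_inv_act (σ : Perm (Fin n)) (q : MvPolynomial V K) : A σ⁻¹ (A σ q) = q := by
  rw [← act_mul_apply, inv_mul_cancel, act_one]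

/-- Exchanging two indices through a common partner: `(a b) = (a m)(b m)(a m)`. [folklore] -/
theorem act_swap_eq_of_partner {q : MvPolynomial V K} {a b m : Fin n} (hab : a ≠ b) (hbm : b ≠ m)
    (ha : A (swap a m) q = q) (hb : A (swap b m) q = q) : A (swap a b) q = q := by
  have h : swap a b = swap a m * swap b m * swap a m := by
    have := Equiv.swap_mul_swap_mul_swap (x := b) (y := a) (z := m) hab.symm hbm
    rw [swap_comm b a] at this
    calc swap a b = swap a m * (swap a m * swap a b * swap a m) * swap a m := by
          rw [← mul_assoc, ← mul_assoc, swap_mul_self, one_mul, mul_assoc, swap_mul_self, mul_one]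
      _ = swap a m * swap m b * swap a m := by rw [this]
      _ = swap a m * swap b m * swap a m := by rw [swap_comm m b]
  rw [h, act_mul_apply, act_mul_apply, ha, hb, ha]

/-- **The canonical support assignment of an abstract action.**  There is `supp : K[V] → Finset (Fin n)` with:
(S1) `supp (u · q) = supp q` for `u ≠ 0`; (S2) `supp (A σ q) = σ • supp q`; (S2') `supp (B q) = supp q` for every
algebra automorphism `B` commuting with the action; (S3) whenever the pointwise stabiliser of some `X` with
`2|X| + 5 ≤ n` fixes `q`, then `|supp q| ≤ |X|` and the pointwise stabiliser of `supp q` fixes `q`.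
[folklore; cite: DawarWilsenach2025, Def. 6.1] -/
theorem exists_supportAssignment :
    ∃ supp : MvPolynomial V K → Finset (Fin n),
      (∀ (q : MvPolynomial V K) (u : K), u ≠ 0 → supp (C u * q) = supp q) ∧
      (∀ (q : MvPolynomial V K) (σ : Perm (Fin n)), supp (A σ q) = σ • supp q) ∧
      (∀ B : MvPolynomial V K ≃ₐ[K] MvPolynomial V K, (∀ (ρ : Perm (Fin n)) (q : MvPolynomial V K),
          B (A ρ q) = A ρ (B q)) → ∀ q : MvPolynomial V K, supp (B q) = supp q) ∧
      (∀ (q : MvPolynomial V K) (X : Finset (Fin n)), 2 * X.card + 5 ≤ n →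
        (∀ τ : Perm (Fin n), (∀ x ∈ X, τ x = x) → A τ q = q) →
        (supp q).card ≤ X.card ∧ ∀ τ : Perm (Fin n), (∀ x ∈ supp q, τ x = x) → A τ q = q) := by
  -- partners of `i`: the `j` with `(i j) · q = q`
  let P : MvPolynomial V K → Fin n → Finset (Fin n) := fun q i =>
    (univ : Finset (Fin n)).filter fun j => A (swap i j) q = q
  let supp : MvPolynomial V K → Finset (Fin n) := fun q =>
    (univ : Finset (Fin n)).filter fun i => (P q i).card ≤ n / 2 + 1
  have hP : ∀ q i j, j ∈ P q i ↔ A (swap i j) q = q := fun q i j => by simp [P]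
  have hsupp : ∀ q i, i ∈ supp q ↔ (P q i).card ≤ n / 2 + 1 := fun q i => by simp [supp]
  refine ⟨supp, fun q u hu => ?_, fun q σ => ?_, fun B hB q => ?_, fun q X hX hfix => ?_⟩
  · -- (S1)
    have hPq : ∀ i, P (C u * q) i = P q i := by
      intro i
      ext j
      rw [hP, hP, map_mul, act_C]
      constructor
      · intro h
        exact mul_left_cancel₀ (show (C u : MvPolynomial V K) ≠ 0 from by
          rw [Ne, MvPolynomial.C_eq_zero]; exact hu) h
      · intro h; rw [h]
    ext i
    rw [hsupp, hsupp, hPq]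
  · -- (S2)
    have hconj : ∀ i j : Fin n, swap i j = σ * swap (σ⁻¹ i) (σ⁻¹ j) * σ⁻¹ := by
      intro i j
      have := Equiv.swap_apply_apply σ (σ⁻¹ i) (σ⁻¹ j)
      rwa [show σ (σ⁻¹ i) = i from σ.apply_symm_apply i, show σ (σ⁻¹ j) = j from σ.apply_symm_apply j] at this
    have hiff : ∀ i j : Fin n, A (swap i j) (A σ q) = A σ q ↔ A (swap (σ⁻¹ i) (σ⁻¹ j)) q = q := by
      intro i j
      rw [hconj i j, act_mul_apply, act_mul_apply, act_inv_act]
      exact (A σ).injective.eq_iff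
    have hPσ : ∀ i, P (A σ q) i = σ • P q (σ⁻¹ i) := by
      intro i
      ext j
      rw [hP, hiff, Finset.mem_smul_finset]
      constructor
      · intro h
        exact ⟨σ⁻¹ j, (hP _ _ _).2 h, σ.apply_symm_apply j⟩
      · rintro ⟨j', hj', rfl⟩
        rw [Perm.smul_def, show σ⁻¹ (σ j') = j' from σ.symm_apply_apply j']
        exact (hP _ _ _).1 hj'
    ext i
    rw [hsupp, hPσ, Finset.card_smul_finset, Finset.mem_smul_finset]
    constructor
    · intro h; exact ⟨σ⁻¹ i, (hsupp _ _).2 h, σ.apply_symm_apply i⟩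
    · rintro ⟨i', hi', rfl⟩
      rw [Perm.smul_def, show σ⁻¹ (σ i') = i' from σ.symm_apply_apply i']
      exact (hsupp _ _).1 hi'
  · -- (S2') an automorphism commuting with the action does not change partners
    have hPq : ∀ i, P (B q) i = P q i := by
      intro i
      ext j
      rw [hP, hP, ← hB]
      exact B.injective.eq_iff
    ext i
    rw [hsupp, hsupp, hPq]
  · -- (S3)
    have hbig : ∀ i, i ∉ X → n / 2 + 1 < (P q i).card := by
      intro i hi
      have hsub : Xᶜ ⊆ P q i := by
        intro j hj
        rw [Finset.mem_compl] at hj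
        rw [hP]
        by_cases hij : i = j
        · subst hij; rw [swap_self]; exact act_one A q
        · exact hfix _ fun x hx => swap_apply_of_ne_of_ne (by rintro rfl; exact hi hx) (by rintro rfl; exact hj hx)
      have := Finset.card_le_card hsub
      rw [Finset.card_compl, Fintype.card_fin] at this
      omega
    have hsub : supp q ⊆ X := by
      intro i hi
      by_contra hiX
      have := (hsupp q i).1 hi
      have := hbig i hiX
      omega
    refine ⟨Finset.card_le_card hsub, ?_⟩
    have hswap : ∀ a b, a ∉ supp q → b ∉ supp q → A (swap a b) q = q := by
      intro a b ha hb
      by_cases hab : a = b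
      · subst hab; rw [swap_self]; exact act_one A q
      rw [hsupp, not_le] at ha hb
      have hcard : 0 < ((P q a ∩ P q b) \ {a, b}).card := by
        have h1 : (P q a ∩ P q b).card + (P q a ∪ P q b).card = (P q a).card + (P q b).card :=
          Finset.card_inter_add_card_union _ _
        have h2 : (P q a ∪ P q b).card ≤ n := by
          have := Finset.card_le_univ (P q a ∪ P q b); rwa [Fintype.card_fin] at this
        have h3 : ((P q a ∩ P q b) \ {a, b}).card + ({a, b} : Finset (Fin n)).card ≥ (P q a ∩ P q b).card := by
          have := Finset.card_le_card_sdiff_add_card (s := P q a ∩ P q b) (t := {a, b})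
          omega
        have h4 : ({a, b} : Finset (Fin n)).card = 2 := Finset.card_pair hab
        omega
      obtain ⟨m, hm⟩ : ((P q a ∩ P q b) \ {a, b}).Nonempty := Finset.card_pos.1 hcard
      simp only [Finset.mem_sdiff, Finset.mem_inter, Finset.mem_insert, Finset.mem_singleton, not_or] at hm
      exact act_swap_eq_of_partner A hab (Ne.symm hm.2.2) ((hP _ _ _).1 hm.1.1) ((hP _ _ _).1 hm.1.2)
    intro τ hτ
    have hτp : ∀ x, τ x ∉ supp q ↔ x ∉ supp q := by
      intro x
      by_cases hx : x ∈ supp q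
      · rw [hτ x hx]
      · refine ⟨fun _ => hx, fun _ hτx => ?_⟩
        have h1 : τ (τ x) = τ x := hτ _ hτx
        exact hx (τ.injective h1 ▸ hτx)
    have h2 : ∀ x, τ x ≠ x → x ∉ supp q := fun x hx hxS => hx (hτ x hxS)
    have key : ∀ π : Perm {x // x ∉ supp q}, A (Perm.ofSubtype π) q = q := by
      intro π
      induction π using Perm.swap_induction_on with
      | one => rw [map_one, act_one]
      | swap_mul π x y hxy ih => rw [map_mul, Perm.ofSubtype_swap_eq, act_mul_apply, ih, hswap _ _ x.2 y.2]
    have := key (τ.subtypePerm hτp)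
    rwa [Perm.ofSubtype_subtypePerm hτp h2] at this

end Abstract

/-! ### Row and column supports on the matrix -/

/-- The pure row and pure column actions commute. [folklore] -/
theorem row_col_comm (σ τ : Perm (Fin n)) (q : MvPolynomial (Fin n × Fin n) K) :
    vact (K := K) rowHom σ (vact (K := K) colHom τ q) = vact (K := K) colHom τ (vact (K := K) rowHom σ q) := by
  rw [vact_apply, vact_apply, vact_apply, vact_apply, rename_rename, rename_rename]
  rfl

/-- **ROW AND COLUMN SUPPORTS.**  On `K[x_ij : i, j < n]` there are `R, C : K[x_ij] → Finset (Fin n)` with: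
unit-invariance; `R (row σ · q) = σ • R q`, `R (col τ · q) = R q`, `C (col τ · q) = τ • C q`,
`C (row σ · q) = C q`; DIAGONAL equivariance `R (ren σ q) = σ • R q`, `C (ren σ q) = σ • C q`; and (S3): if the
row (column) permutations fixing pointwise some `X` with `2|X| + 5 ≤ n` fix `q`, then `|R q| ≤ |X|`
(`|C q| ≤ |X|`) and the row (column) permutations fixing `R q` (`C q`) pointwise fix `q`.
[folklore; cite: DawarWilsenach2025, Def. 6.1] -/
theorem exists_rowColSupports (n : ℕ) :
    ∃ R C : MvPolynomial (Fin n × Fin n) K → Finset (Fin n),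
      (∀ (q : MvPolynomial (Fin n × Fin n) K) (u : K), u ≠ 0 → R (MvPolynomial.C u * q) = R q) ∧
      (∀ (q : MvPolynomial (Fin n × Fin n) K) (u : K), u ≠ 0 → C (MvPolynomial.C u * q) = C q) ∧
      (∀ (q : MvPolynomial (Fin n × Fin n) K) (σ : Perm (Fin n)), R (vact (K := K) rowHom σ q) = σ • R q) ∧
      (∀ (q : MvPolynomial (Fin n × Fin n) K) (τ : Perm (Fin n)), R (vact (K := K) colHom τ q) = R q) ∧
      (∀ (q : MvPolynomial (Fin n × Fin n) K) (τ : Perm (Fin n)), C (vact (K := K) colHom τ q) = τ • C q) ∧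
      (∀ (q : MvPolynomial (Fin n × Fin n) K) (σ : Perm (Fin n)), C (vact (K := K) rowHom σ q) = C q) ∧
      (∀ (q : MvPolynomial (Fin n × Fin n) K) (σ : Perm (Fin n)), R (ren σ q) = σ • R q) ∧
      (∀ (q : MvPolynomial (Fin n × Fin n) K) (σ : Perm (Fin n)), C (ren σ q) = σ • C q) ∧
      (∀ (q : MvPolynomial (Fin n × Fin n) K) (X : Finset (Fin n)), 2 * X.card + 5 ≤ n →
        (∀ τ : Perm (Fin n), (∀ x ∈ X, τ x = x) → vact (K := K) rowHom τ q = q) →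
        (R q).card ≤ X.card ∧ ∀ τ : Perm (Fin n), (∀ x ∈ R q, τ x = x) → vact (K := K) rowHom τ q = q) ∧
      (∀ (q : MvPolynomial (Fin n × Fin n) K) (X : Finset (Fin n)), 2 * X.card + 5 ≤ n →
        (∀ τ : Perm (Fin n), (∀ x ∈ X, τ x = x) → vact (K := K) colHom τ q = q) →
        (C q).card ≤ X.card ∧ ∀ τ : Perm (Fin n), (∀ x ∈ C q, τ x = x) → vact (K := K) colHom τ q = q) := by
  obtain ⟨R, R1, R2, R2', R3⟩ := exists_supportAssignment (vact (K := K) (rowHom (n := n)))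
  obtain ⟨C, C1, C2, C2', C3⟩ := exists_supportAssignment (vact (K := K) (colHom (n := n)))
  have hRcol : ∀ (q : MvPolynomial (Fin n × Fin n) K) (τ : Perm (Fin n)), R (vact (K := K) colHom τ q) = R q :=
    fun q τ => R2' (vact (K := K) colHom τ) (fun ρ p => (row_col_comm ρ τ p).symm) q
  have hCrow : ∀ (q : MvPolynomial (Fin n × Fin n) K) (σ : Perm (Fin n)), C (vact (K := K) rowHom σ q) = C q :=
    fun q σ => C2' (vact (K := K) rowHom σ) (fun ρ p => row_col_comm σ ρ p) q
  refine ⟨R, C, R1, C1, R2, hRcol, C2, hCrow, fun q σ => ?_, fun q σ => ?_, R3, C3⟩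
  · rw [ren_eq_row_col, R2, hRcol]
  · rw [ren_eq_row_col, hCrow, C2]

end RowColSupport

end Summit.ValiantsHypothesis.ValiantsHypothesis.Theorems

end
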